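import Summits.SmoothPoincare4.SmoothPoincare4.Theorems.RootDecompAEDoublesShadowTwoRoeLocalStep

/-!
# Grade-two dichotomy for KMN encoding graphs (Roe certificates), part 13/17: structural peeling certificates; the peeling recursion

§10 `BlocksOK`, `PCert` (an elimination order of the pieces with a partition of the rows into owned rows, each block
locally certified with far ends peeled before) and `peel_rec`: every peeling state with unimodular block admits one
(strong induction on the sub-tree, leaf removal, TOP/BOTTOM split of the determinant).

THE FAMILY (16 modules `Theorems/RootDecompAEDoublesShadowTwoRoe*.lean` + the closing module
`Theorems/RootDecompAEDoublesShadowTwoStubGradeTwoDichotomy.lean`, one namespace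
`Summit.SmoothPoincare4.SmoothPoincare4.Theorems.RootDecompAEDoublesShadowTwoStubGradeTwoDichotomy`, chained imports,
split by topic to respect the 400-line bound on proof files; the local-table parts import only `…RoeDefs`).
-/

open Function
open Literature.Topology.FourManifolds

set_option linter.dupNamespace false

noncomputable section

namespace Summit.SmoothPoincare4.SmoothPoincare4.Theorems.RootDecompAEDoublesShadowTwoStubGradeTwoDichotomy

/-! ## §10 Structural peeling certificates and the peeling recursion -/

namespace ShadowGraph

variable (G₂ : ShadowGraph)

/-- THE BLOCKS of a structural certificate are fine relative to the pieces `L` eliminated before them: every owned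
row is a row at the block's piece whose far end is eliminated earlier, and the piece has a local elimination
certificate on exactly the owned ports. -/
def BlocksOK : Finset (Fin G₂.k) → List (Fin G₂.k × Finset (Fin G₂.m)) → Prop
  | _, [] => True
  | L, b :: rest => (∀ e ∈ b.2, ((G₂.src e).1 = b.1 ∨ (G₂.tgt e).1 = b.1) ∧ G₂.other e b.1 ∈ L) ∧
      LocalCert (G₂.piece b.1) (G₂.uports b.2 b.1) ∧ BlocksOK (insert b.1 L) rest

/-- A STRUCTURAL PEELING CERTIFICATE of the state `(R, L)`: an elimination order of the pieces of `R` (each exactly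
once) with a partition of the rows of the state into owned rows, fine in the above sense. -/
def PCert (R L : Finset (Fin G₂.k)) (bs : List (Fin G₂.k × Finset (Fin G₂.m))) : Prop :=
  (bs.map Prod.fst).Nodup ∧ (∀ v, v ∈ bs.map Prod.fst ↔ v ∈ R) ∧ bs.Pairwise (fun b b' => Disjoint b.2 b'.2) ∧
    (∀ e, e ∈ G₂.rows R L ↔ ∃ b ∈ bs, e ∈ b.2) ∧ G₂.BlocksOK L bs

variable {G₂}

/-- Unfolding `BlocksOK` on a cons. -/
theorem blocksOK_cons {L : Finset (Fin G₂.k)} {b : Fin G₂.k × Finset (Fin G₂.m)} {rest : List (Fin G₂.k × Finset (Fin G₂.m))} :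
    G₂.BlocksOK L (b :: rest) ↔ (∀ e ∈ b.2, ((G₂.src e).1 = b.1 ∨ (G₂.tgt e).1 = b.1) ∧ G₂.other e b.1 ∈ L) ∧
      LocalCert (G₂.piece b.1) (G₂.uports b.2 b.1) ∧ G₂.BlocksOK (insert b.1 L) rest := by
  rw [BlocksOK]

/-- `BlocksOK` on the empty list. -/
theorem blocksOK_nil {L : Finset (Fin G₂.k)} : G₂.BlocksOK L [] := by
  rw [BlocksOK]; trivial

/-- Appending a block that is fine relative to `L` and all earlier pieces. -/
theorem blocksOK_append {L : Finset (Fin G₂.k)} {bs : List (Fin G₂.k × Finset (Fin G₂.m))}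
    {b : Fin G₂.k × Finset (Fin G₂.m)} (h₁ : G₂.BlocksOK L bs)
    (h₂ : G₂.BlocksOK (L ∪ (bs.map Prod.fst).toFinset) [b]) : G₂.BlocksOK L (bs ++ [b]) := by
  induction bs generalizing L with
  | nil => simpa using h₂
  | cons b' rest ih =>
    rw [List.cons_append, blocksOK_cons]
    rw [blocksOK_cons] at h₁
    obtain ⟨ha, hc, hr⟩ := h₁
    refine ⟨ha, hc, ih hr ?_⟩
    have e : insert b'.1 L ∪ (rest.map Prod.fst).toFinset = L ∪ ((b' :: rest).map Prod.fst).toFinset := by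
      ext x
      simp only [Finset.mem_union, Finset.mem_insert, List.mem_toFinset, List.map_cons, List.mem_cons]
      tauto
    rw [e]
    exact h₂

/-- The owned rows of a certificate are rows of the state. -/
theorem PCert.own_sub {R L : Finset (Fin G₂.k)} {bs : List (Fin G₂.k × Finset (Fin G₂.m))} (h : G₂.PCert R L bs)
    {b : Fin G₂.k × Finset (Fin G₂.m)} (hb : b ∈ bs) {e : Fin G₂.m} (he : e ∈ b.2) : e ∈ G₂.rows R L :=
  (h.2.2.2.1 e).mpr ⟨b, hb, he⟩

variable (G₂)

/-- **PEELING.**  Every peeling state `(R, L)` (`R` a sub-tree of pieces still to peel, `L` the pieces already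
peeled to the bottom, `R ∩ L = ∅`) whose block `rows(R, L) × cols(R)` of the exponent table is unimodular admits a
structural peeling certificate.  Induction on `#R`: peel a leaf `u` of `R`; the rank bounds force the number of cap
rows at `u` to be `rank(u)` (BOTTOM: `u` is eliminated first and joins `L`) or `rank(u) − 1` (TOP: `u` also owns the
edge towards `R` and is eliminated last); the determinant factors through the corresponding block-triangular
shape, the local step certifies the block at `u`, and the induction hypothesis the rest. -/
theorem peel_rec (hV : G₂.PortsValid) (hI : G₂.PortsInjective) (hT : G₂.IsSpanningTree) (hall : ∀ e, G₂.tree e = true) :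
    ∀ (n : ℕ) (R L : Finset (Fin G₂.k)), R.card = n + 1 → Disjoint R L →
      (G₂.treeAdj.induce (R : Set (Fin G₂.k))).Connected → UM G₂.tab (G₂.rows R L) (G₂.cols R) →
        ∃ bs, G₂.PCert R L bs := by
  classical
  have hself : ∀ e, (G₂.src e).1 ≠ (G₂.tgt e).1 := fun e => hT.1 e (hall e)
  obtain ⟨-, hinjE, -⟩ := G₂.tree_facts₂ hT hall
  intro n
  induction n with
  | zero =>
    intro R L hcard hRL _ hU
    obtain ⟨u, rfl⟩ := Finset.card_eq_one.mp hcard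
    -- every row touches `u`, and its far end lies in `L`
    have hru : ∀ e ∈ G₂.rows {u} L, (G₂.src e).1 = u ∨ (G₂.tgt e).1 = u := by
      intro e he
      rw [mem_rows₂] at he
      simp only [Finset.mem_singleton] at he
      tauto
    have hoL : ∀ e ∈ G₂.rows {u} L, G₂.other e u ∈ L := by
      intro e he
      rcases other_mem₂ he (hru e he) with h | h
      · rw [Finset.mem_singleton] at h; exact absurd h (other_ne₂ (hself e))
      · exact h
    have hloc := localCert_of_um hV hI hself hru hU
    refine ⟨[(u, G₂.rows {u} L)], List.nodup_singleton u, fun v => by simp, List.pairwise_singleton _ _,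
      fun e => by simp, ?_⟩
    rw [blocksOK_cons]
    exact ⟨fun e he => ⟨hru e he, hoL e he⟩, hloc, blocksOK_nil⟩
  | succ n ih =>
    intro R L hcard hRL hconn hU
    obtain ⟨u, hu, z, hz, huz, hadj, huniq, hconn'⟩ := G₂.exists_leaf₂ hT hall R hconn (by omega)
    have huL : u ∉ L := fun h => Finset.disjoint_left.mp hRL hu h
    obtain ⟨-, δ, -, hδ⟩ := (G₂.treeAdj_iff₂ u z).mp hadj
    have hδt := (touches_of_epair₂ hδ).1
    have hδo : G₂.other δ u = z := other_eq_of_epair₂ (hself δ) hδ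
    have hδrows : δ ∈ G₂.rows R L := by
      rw [mem_rows₂]
      rcases ends_eq₂ hδt with ⟨h1, h2⟩ | ⟨h1, h2⟩
      · exact Or.inl ⟨h1 ▸ hu, Or.inl (by rw [h2, hδo]; exact hz)⟩
      · exact Or.inr ⟨h1 ▸ hu, Or.inl (by rw [h2, hδo]; exact hz)⟩
    have hδu : δ ∈ G₂.urows R L u := mem_urows₂.mpr ⟨hδrows, hδt⟩
    -- cap rows: every other row at `u` ends in `L`
    have hS : ∀ e ∈ G₂.urows R L u, e ≠ δ → G₂.other e u ∈ L := by
      intro e he hne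
      obtain ⟨heR, ht⟩ := mem_urows₂.mp he
      rcases other_mem₂ heR ht with h | h
      · exfalso
        have hw : G₂.other e u = z := huniq _ h (adj_other₂ hall (hself e) ht)
        have : G₂.epair e = G₂.epair δ := by rw [epair_eq₂ ht, hw, hδ]
        exact hne (hinjE this)
      · exact h
    set S := (G₂.urows R L u).erase δ with hSdef
    have hSsub : S ⊆ G₂.rows R L := fun e he =>
      (mem_urows₂.mp (Finset.mem_of_mem_erase he)).1
    have hurows_card : (G₂.urows R L u).card = S.card + 1 := by
      rw [hSdef, Finset.card_erase_of_mem hδu]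
      have := Finset.card_pos.mpr ⟨δ, hδu⟩
      omega
    have hR'card : (R.erase u).card = n + 1 := by rw [Finset.card_erase_of_mem hu]; omega
    have hR'L : Disjoint (R.erase u) L :=
      Finset.disjoint_of_subset_left (Finset.erase_subset u R) hRL
    -- the used letters of `u`
    have hcu_card : (G₂.cols {u}).card = (G₂.piece u).rank := G₂.cols_singleton_card₂ u
    have hcols := G₂.cols_eq_union₂ R u hu
    have hcdisj := G₂.cols_disjoint₂ R u
    -- rank bounds: `#S ≤ rank u ≤ #S + 1`
    have hle1 : S.card ≤ (G₂.cols {u}).card := by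
      refine hU.card_le_of_rows_supported hSsub fun e he g hg hgu => ?_
      obtain ⟨v, i, rfl, hv, hi⟩ := (G₂.mem_cols_iff₂ _ _).mp hg
      have hvu : v ≠ u := fun h => hgu (by rw [inl_mem_cols]; exact ⟨by simp [h], h ▸ hi⟩)
      obtain ⟨hed, heu⟩ := Finset.mem_erase.mp he
      obtain ⟨heR, ht⟩ := mem_urows₂.mp heu
      have hoL := hS e heu hed
      have hvo : v ≠ G₂.other e u := fun h => Finset.disjoint_left.mp hRL hv (h ▸ hoL)
      obtain ⟨h1, h2⟩ := ne_ends_of_ne₂ ht hvu hvo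
      exact tab_far h1 h2 i
    have hle2 : (G₂.cols {u}).card ≤ (G₂.urows R L u).card := by
      refine hU.card_le_of_cols_supported (G₂.cols_mono₂ (Finset.singleton_subset_iff.mpr hu)) fun g hg e he heu => ?_
      obtain ⟨v, i, rfl, hv, -⟩ := (G₂.mem_cols_iff₂ _ _).mp hg
      rw [Finset.mem_singleton] at hv
      subst hv
      have ht : ¬((G₂.src e).1 = v ∨ (G₂.tgt e).1 = v) := fun h => heu (mem_urows₂.mpr ⟨he, h⟩)
      push Not at ht
      exact tab_far ht.1 ht.2 i
    rw [hcu_card] at hle1 hle2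
    rw [hurows_card] at hle2
    rcases Nat.eq_or_lt_of_le hle1 with hbot | htop
    · -- BOTTOM: `u` has `rank u` cap rows; it is eliminated first and joins `L`
      obtain ⟨hrows, hdisj⟩ := rows_split_bot₂ hself hRL hu δ hδu (hδo ▸ hz) hS
      have hU' := hU
      rw [hrows, hcols] at hU'
      have hzero : ∀ i ∈ S, ∀ j ∈ G₂.cols (R.erase u), G₂.tab i j = 0 := by
        intro e he g hg
        obtain ⟨v, i, rfl, hv, -⟩ := (G₂.mem_cols_iff₂ _ _).mp hg
        obtain ⟨hvu, hvR⟩ := Finset.mem_erase.mp hv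
        obtain ⟨hed, heu⟩ := Finset.mem_erase.mp he
        obtain ⟨heR, ht⟩ := mem_urows₂.mp heu
        have hoL := hS e heu hed
        have hvo : v ≠ G₂.other e u := fun h => Finset.disjoint_left.mp hRL hvR (h ▸ hoL)
        obtain ⟨h1, h2⟩ := ne_ends_of_ne₂ ht hvu hvo
        exact tab_far h1 h2 i
      obtain ⟨hUu, hUr⟩ := hU'.split_bot hdisj hcdisj (by rw [hcu_card]; exact hbot) hzero
      have hR'L' : Disjoint (R.erase u) (insert u L) := by
        rw [Finset.disjoint_insert_right]
        exact ⟨by simp, hR'L⟩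
      obtain ⟨bs', hnd', hfst', hpw', hrows', hok'⟩ := ih (R.erase u) (insert u L) hR'card hR'L' hconn' hUr
      have hruS : ∀ e ∈ S, (G₂.src e).1 = u ∨ (G₂.tgt e).1 = u := fun e he =>
        (mem_urows₂.mp (Finset.mem_of_mem_erase he)).2
      have hloc := localCert_of_um hV hI hself hruS hUu
      refine ⟨(u, S) :: bs', ?_, ?_, ?_, ?_, ?_⟩
      · rw [List.map_cons, List.nodup_cons]
        exact ⟨fun h => by simpa using (hfst' u).mp h, hnd'⟩
      · intro v
        rw [List.map_cons, List.mem_cons, hfst' v, Finset.mem_erase]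
        constructor
        · rintro (rfl | ⟨-, h⟩); exacts [hu, h]
        · intro h; by_cases hvu : v = u; exacts [Or.inl hvu, Or.inr ⟨hvu, h⟩]
      · rw [List.pairwise_cons]
        refine ⟨fun b hb => Finset.disjoint_left.mpr fun e heS heb => ?_, hpw'⟩
        exact Finset.disjoint_left.mp hdisj heS ((hrows' e).mpr ⟨b, hb, heb⟩)
      · intro e
        rw [hrows, Finset.mem_union, hrows' e]
        constructor
        · rintro (h | ⟨b, hb, heb⟩)
          · exact ⟨(u, S), List.mem_cons_self, h⟩
          · exact ⟨b, List.mem_cons_of_mem _ hb, heb⟩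
        · rintro ⟨b, hb, heb⟩
          rcases List.mem_cons.mp hb with rfl | hb
          · exact Or.inl heb
          · exact Or.inr ⟨b, hb, heb⟩
      · rw [blocksOK_cons]
        exact ⟨fun e he => ⟨hruS e he, hS e (Finset.mem_of_mem_erase he) (Finset.mem_erase.mp he).1⟩, hloc, hok'⟩
    · -- TOP: `u` has `rank u − 1` cap rows and owns the edge towards `R`; it is eliminated last
      have htop' : (G₂.urows R L u).card = (G₂.piece u).rank := by omega
      obtain ⟨hrows, hdisj, havoid⟩ := rows_split_top₂ (G₂ := G₂) (R := R) (L := L) huL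
      have hU' := hU
      rw [hrows, hcols] at hU'
      have hzero : ∀ i ∈ G₂.rows (R.erase u) L, ∀ j ∈ G₂.cols {u}, G₂.tab i j = 0 := by
        intro e he g hg
        obtain ⟨v, i, rfl, hv, -⟩ := (G₂.mem_cols_iff₂ _ _).mp hg
        rw [Finset.mem_singleton] at hv
        subst hv
        obtain ⟨h1, h2⟩ := havoid e he
        exact tab_far h1 h2 i
      obtain ⟨hUu, hUr⟩ := hU'.split_top hdisj hcdisj (by rw [hcu_card]; exact htop') hzero
      obtain ⟨bs', hnd', hfst', hpw', hrows', hok'⟩ := ih (R.erase u) L hR'card hR'L hconn' hUr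
      have hruU : ∀ e ∈ G₂.urows R L u, (G₂.src e).1 = u ∨ (G₂.tgt e).1 = u := fun e he => (mem_urows₂.mp he).2
      have hloc := localCert_of_um hV hI hself hruU hUu
      have huN : u ∉ bs'.map Prod.fst := fun h => by simpa using (hfst' u).mp h
      refine ⟨bs' ++ [(u, G₂.urows R L u)], ?_, ?_, ?_, ?_, ?_⟩
      · rw [List.map_append, List.nodup_append]
        refine ⟨hnd', by simp, ?_⟩
        intro v hv w hw
        simp only [List.map_cons, List.map_nil, List.mem_singleton] at hw
        rintro rfl
        exact huN (hw ▸ hv)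
      · intro v
        rw [List.map_append, List.mem_append, hfst' v, Finset.mem_erase]
        simp only [List.map_cons, List.map_nil, List.mem_singleton]
        constructor
        · rintro (⟨-, h⟩ | rfl); exacts [h, hu]
        · intro h; by_cases hvu : v = u; exacts [Or.inr hvu, Or.inl ⟨hvu, h⟩]
      · rw [List.pairwise_append]
        refine ⟨hpw', List.pairwise_singleton _ _, fun b hb b' hb' => ?_⟩
        rw [List.mem_singleton] at hb'
        subst hb'
        exact Finset.disjoint_left.mpr fun e heb heU =>
          Finset.disjoint_left.mp hdisj heU ((hrows' e).mpr ⟨b, hb, heb⟩)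
      · intro e
        rw [hrows, Finset.mem_union, hrows' e]
        constructor
        · rintro (h | ⟨b, hb, heb⟩)
          · exact ⟨(u, G₂.urows R L u), List.mem_append_right _ List.mem_cons_self, h⟩
          · exact ⟨b, List.mem_append_left _ hb, heb⟩
        · rintro ⟨b, hb, heb⟩
          rcases List.mem_append.mp hb with hb | hb
          · exact Or.inr ⟨b, hb, heb⟩
          · rw [List.mem_singleton] at hb
            subst hb
            exact Or.inl heb
      · refine blocksOK_append hok' ?_
        rw [blocksOK_cons]
        refine ⟨fun e he => ⟨hruU e he, ?_⟩, hloc, blocksOK_nil⟩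
        obtain ⟨heR, ht⟩ := mem_urows₂.mp he
        rw [Finset.mem_union, List.mem_toFinset, hfst', Finset.mem_erase]
        rcases other_mem₂ heR ht with h | h
        · exact Or.inr ⟨other_ne₂ (hself e), h⟩
        · exact Or.inl h

end ShadowGraph

end Summit.SmoothPoincare4.SmoothPoincare4.Theorems.RootDecompAEDoublesShadowTwoStubGradeTwoDichotomy
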